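import Literature.IUT.HodgeArakelov.GoodPrimeKummerBridge
import Literature.IUT.HodgeArakelov.GoodPrimeKummerBridgeProofs
import Literature.AnabelianGeometry.AbsoluteAnabelian.MonoidKummerMapsLiftOfUnitsTransport
import Literature.AnabelianGeometry.AbsoluteAnabelian.MonoidKummerMapsTLGLiftCompactProofs
import Literature.AnabelianGeometry.AbsoluteAnabelian.MonoidKummerMapsMonoAnalyticLiftProofs
import Literature.AnabelianGeometry.AbsoluteAnabelian.AbsAnabUnitsTransportHolds
import HarnessLib

/-!
# [IUTchII] Prop 4.2 (i), (ii) [unit part] at good nonarchimedean primes — the named lifting hypotheses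
# DISCHARGED (proof-only companion of `GoodPrimeKummerBridge.lean`)

S. Mochizuki, *Inter-universal Teichmüller theory II*, §4, kurims manuscript (Dec. 2020), Proposition 4.2
(i), (ii) p. 124 (`v ∈ V^good ∩ V^non`) [cite: Mochizuki2012, Prop 4.2 (i) p.124]. Claim key DISPUTED (D-0012).

`GoodPrimeKummerBridge.lean` (abc-iut-L6-t5, p415949) proved the uniqueness / torsor halves of Prop 4.2 (i) and
(ii)-unit part and took the existence of ONE lift from the named statements
`GaloisIsoLiftsToTMPairIsoOfMonoAnalytic` (FACT-LIST F-0410, [IUTchII] Rmk 1.11.1 (i)(a)) /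
`TCGPairIsoLiftsOfMonoAnalytic` (F-0411, Rmk 1.11.1 (i)(b)) / the schema `GaloisIsoLiftsToTMPairIso H` (F-0409,
[AbsTopIII] Prop 3.2 (iv) as corrected) BY NAME. These statements are now CONSEQUENCES OF TREE THEOREMS:
abc-iut-L4-d3's `Prop121vii.unitsTransport_holds` ([AbsAnab] Prop 1.2.1 (vi)/(vii): local class field theory
transports `K̄^×` equivariantly along any isomorphism of absolute Galois groups), abc-iut-L6-t13's
`galoisIsoLiftsToTMPairIsoOfMonoAnalytic_of_unitsTransport` / `tcgPairIsoLiftsOfMonoAnalytic_of_unitsTransport`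
(mono-analytic forms) and `galoisIsoLiftsToTMPairIso_of_biAnabelianUnits_of_compact` with
`biAnabelianUnits_of_unitsTransport` (the `H`-schema for every hypothesis predicate forcing compact `Π`),
over abc-iut-L6-d1's bi-anabelian reduction and abc-iut-L6-t21's `TM ⇐ TLG` reduction. THIS FILE plugs them in:

* `prop42i_of_monoAnalytic` — [IUTchII] Prop 4.2 (i) for `TM`-pairs OF MONO-ANALYTIC TYPE (both monoids acted
  on by isomorphs of `G_v(†Π_v)` itself, as printed): UNCONDITIONAL, over every identification `f`;
* `prop42iiUnit_of_monoAnalytic` — the unit part of Prop 4.2 (ii) for `TCG`-pairs of mono-analytic type: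
  UNCONDITIONAL;
* `prop42i_of_compactType` — Prop 4.2 (i) in the shape of its second reference [AbsTopIII] Prop 3.2 (iv), for
  any type predicate `H` forcing compact `Π` (the profinite étale fundamental group of a hyperbolic orbicurve
  is compact) and identifications respecting the arithmetic quotients: UNCONDITIONAL.

(abc-iut-L6-t13's announced closer `MonoidKummerMapsMonoAnalyticLiftHolds.lean` names the intermediate facts
`…_holds`; the statements here consume the same tree theorems directly and coincide with that route by proof
irrelevance.) Theorems only; nothing here bears on [IUTchIII] Cor. 3.12 or takes a side.
-/

namespace Literature.IUT.HodgeArakelov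

open Literature.AnabelianGeometry.AbsoluteAnabelian

namespace GoodPrimeKummer

variable {P Q : GaloisMonoidPair.{0}}

/-- [IUTchII] Rmk 1.11.1 (i)(a) / F-0410 as a CONSEQUENCE of tree theorems: mono-analytic `TM` lifting holds
(abc-iut-L6-t13's reduction to `Prop121vii.UnitsTransport`, PROVED by abc-iut-L4-d3).
[cite: Mochizuki2012, IUTchII Rmk 1.11.1 (i) p.50] -/
theorem galoisIsoLiftsToTMPairIsoOfMonoAnalytic_of_tree : GaloisIsoLiftsToTMPairIsoOfMonoAnalytic :=
  galoisIsoLiftsToTMPairIsoOfMonoAnalytic_of_unitsTransport Prop121vii.unitsTransport_holds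

/-- [IUTchII] Rmk 1.11.1 (i)(b) / F-0411 as a CONSEQUENCE of tree theorems: mono-analytic `TCG` lifting holds.
[cite: Mochizuki2012, IUTchII Rmk 1.11.1 (i) p.50] -/
theorem tcgPairIsoLiftsOfMonoAnalytic_of_tree : TCGPairIsoLiftsOfMonoAnalytic :=
  tcgPairIsoLiftsOfMonoAnalytic_of_unitsTransport Prop121vii.unitsTransport_holds

/-- **[IUTchII] Prop 4.2 (i), UNCONDITIONAL for `TM`-pairs of mono-analytic type** (p. 124 "There exists a
unique `G_v(†Π_v)`-equivariant isomorphism of monoids `Ψ_{†F_v} ⥲ Ψ_cns(†Π_v)` — cf. Remark 1.11.1, (i), (a)"): for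
`TM`-pairs `(Π ↷ M)`, `(Π* ↷ M*)` of mono-analytic type (hence MLF-Galois) and any identification `f : Π ⥲ Π*`,
exactly one `f`-equivariant isomorphism of monoids `M ⥲ M*`. [cite: Mochizuki2012, Prop 4.2 (i) p.124] -/
theorem prop42i_of_monoAnalytic (hPm : IsOfMonoAnalyticTypeMonoid .TM P) (hQm : IsOfMonoAnalyticTypeMonoid .TM Q)
    (f : P.Pi ≃ₜ* Q.Pi) : Prop42i P Q f :=
  prop42i_of_monoAnalyticLifts galoisIsoLiftsToTMPairIsoOfMonoAnalytic_of_tree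
    (isMLFGaloisMonoidPair_of_isOfMonoAnalyticTypeMonoid hPm)
    (isMLFGaloisMonoidPair_of_isOfMonoAnalyticTypeMonoid hQm) hPm hQm f

/-- **[IUTchII] Prop 4.2 (ii), unit part, UNCONDITIONAL for `TCG`-pairs of mono-analytic type** (p. 124 "There
exists a unique `†G_v`-equivariant `Ẑ^×`-orbit of isomorphisms of topological groups `Ψ^×_{†F^⊢_v} ⥲ Ψ_cns(†G_v)^×` — cf.
Remark 1.11.1, (i), (b)"): for `TCG`-pairs of mono-analytic type and any identification `f` of the groups, the
`f`-equivariant group isomorphisms form exactly one torsor under `Aut(μ_Ẑ) = Ẑ^×` (`Prop42iiUnit`).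
[cite: Mochizuki2012, Prop 4.2 (ii) p.124] -/
theorem prop42iiUnit_of_monoAnalytic (hPm : IsOfMonoAnalyticTypeMonoid .TCG P)
    (hQm : IsOfMonoAnalyticTypeMonoid .TCG Q) (f : P.Pi ≃ₜ* Q.Pi) : Prop42iiUnit P Q f :=
  prop42iiUnit_of_tcgLifts tcgPairIsoLiftsOfMonoAnalytic_of_tree
    (isMLFGaloisMonoidPair_of_isOfMonoAnalyticTypeMonoid hPm)
    (isMLFGaloisMonoidPair_of_isOfMonoAnalyticTypeMonoid hQm) hPm hQm f

/-- **[IUTchII] Prop 4.2 (i) in the shape of [AbsTopIII] Prop 3.2 (iv) (corrected), UNCONDITIONAL for compact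
`Π`**: for MLF-Galois `TM`-pairs satisfying a type predicate `H` that forces the acting group to be compact
("of hyperbolic orbicurve type": `Π` a profinite étale fundamental group) and an identification `f`
respecting the arithmetic quotients, exactly one `f`-equivariant isomorphism of monoids — the schema
`GaloisIsoLiftsToTMPairIso H` (F-0409) being a tree theorem for such `H` (abc-iut-L6-t13
`galoisIsoLiftsToTMPairIso_of_biAnabelianUnits_of_compact` + `biAnabelianUnits_of_unitsTransport` + abc-iut-L4-d3
`unitsTransport_holds`). [cite: Mochizuki2012, Prop 4.2 (i) p.124] -/
theorem prop42i_of_compactType {H : GaloisMonoidPair.{0} → Prop} (hH : ∀ R, H R → CompactSpace R.Pi)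
    (hP : IsMLFGaloisMonoidPair .TM P) (hQ : IsMLFGaloisMonoidPair .TM Q) (hHP : H P) (hHQ : H Q)
    (f : P.Pi ≃ₜ* Q.Pi) (hf : P.actionKer.map f.toMulEquiv.toMonoidHom = Q.actionKer) : Prop42i P Q f :=
  prop42i_of_galoisIsoLifts
    (galoisIsoLiftsToTMPairIso_of_biAnabelianUnits_of_compact
      (biAnabelianUnits_of_unitsTransport Prop121vii.unitsTransport_holds) H hH)
    hP hQ hHP hHQ f hf


/-! ### v2 (append-only): Remark 4.2.1 (i), the bad-prime analogue of Prop 4.2 (i) — unconditional -/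

section BadPrimes

variable {S : ThetaSetting.{0}} (A : AbsTopMonoids S) (hA : A.ContinuityLaws)

/-- **[IUTchII] Rmk 4.2.1 (i)** (p. 126: "one has analogues of «`Ψ^ss_{†F^⊢_v}`» and of Proposition 4.2, (i), (ii),
in the case of `v ∈ V^bad`"), the (i)-analogue on abc-iut-L6-t1's Ex 1.8 (ii) pairs `(G ↷ O^⊳(G))` — now
UNCONDITIONAL given the merged reading that these pairs are of mono-analytic type: for any two objects
`G`, `H` of the connected groupoid `IsoClass G_v` and any isomorphism `f : G ⟶ H`, exactly one `f`-equivariant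
isomorphism of monoids `O^⊳(G) ⥲ O^⊳(H)` (p416922's `prop42i_toPair_of_monoAnalyticLifts` with its lifting
hypothesis discharged by `galoisIsoLiftsToTMPairIsoOfMonoAnalytic_of_tree`). [cite: Mochizuki2012, Rmk 4.2.1 (i) p.126] -/
theorem prop42i_toPair_of_monoAnalytic (hMA : ∀ G, IsOfMonoAnalyticTypeMonoid .TM (A.toPair hA G))
    {G H : IsoClass S.Gk} (f : G ⟶ H) :
    Prop42i (A.toPair hA G) (A.toPair hA H) (IsoClass.homIso f) :=
  prop42i_of_monoAnalytic (hMA G) (hMA H) (IsoClass.homIso f)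

/-- **Rmk 4.2.1 (i), (i)-analogue, UNCONDITIONAL for MLF-Galois `TM`-pairs of the groupoid** — no lifting
statement at all: abc-iut-L6-t1's transport `mapOtri f` IS an `f`-equivariant isomorphism (p416922
`mapOtri_mem_equivariantIsoOver`) and any other equals it (p416922 `eq_mapOtri_of_mem_equivariantIsoOver`, from
`pairIsoDeterminedByGalois_holds`). [cite: Mochizuki2012, Rmk 4.2.1 (i) p.126] -/
theorem prop42i_toPair (hTM : ∀ G, A.IsTMPair hA G) {G H : IsoClass S.Gk} (f : G ⟶ H) :
    Prop42i (A.toPair hA G) (A.toPair hA H) (IsoClass.homIso f) :=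
  ⟨A.mapOtri f, mapOtri_mem_equivariantIsoOver A hA f,
    fun _ hφ => eq_mapOtri_of_mem_equivariantIsoOver A hA hTM f hφ⟩

end BadPrimes

end GoodPrimeKummer

end Literature.IUT.HodgeArakelov

/-! ## `_holds` aliases (appended 2026-08-28)

The named fact(s) below are already theorems of the tree under another name; the `_holds`
alias records the discharge under the tree's naming convention (D-0026 bookkeeping: proof term =
the existing theorem, no statement or definition edited). -/

/-- `TCGPairIsoLiftsOfMonoAnalytic` is a theorem of the tree (`Literature.IUT.HodgeArakelov.GoodPrimeKummer.tcgPairIsoLiftsOfMonoAnalytic_of_tree`). [cite: MochizukiAbsTopIII2015, Corollary 1.10 p.42] [cite: Mochizuki2012, II Rmk 1.11.1 (i) p.50] -/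
theorem _root_.Literature.AnabelianGeometry.AbsoluteAnabelian.TCGPairIsoLiftsOfMonoAnalytic_holds : _root_.Literature.AnabelianGeometry.AbsoluteAnabelian.TCGPairIsoLiftsOfMonoAnalytic :=
  _root_.Literature.IUT.HodgeArakelov.GoodPrimeKummer.tcgPairIsoLiftsOfMonoAnalytic_of_tree
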